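import Literature.NumberTheory.GaloisRepresentations.LocalDualityTheorem
import HarnessLib

/-!
# CRT splitting of a module killed by a product of two coprime integers: `A = A[a] ⊕ A[b]`,
# `H^q(G, M)[a] ≃ H^q(G, M[a])` (`q = 1, 2`), `M^G[a] ≃ M[a]^G`

Tool theorems (no definitions, no named facts) for assembling statements about finite Galois modules
of COMPOSITE torsion level from their prime-power cases, without direct sums.  For `a`, `b` coprime
natural numbers, a CRT idempotent `e ≡ 1 (mod a)`, `e ≡ 0 (mod b)` (`exists_crt_one_zero`) and an
abelian group / topological `G`-module killed by `ab`:

* §1 `exists_addEquiv_prod_torsionBy_of_coprime`, **`natCard_eq_mul_of_coprime`**: `A ≃ A[a] × A[b]`,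
  `#A = #A[a] · #A[b]` (`A[a]` = Mathlib's `AddSubgroup.torsionBy A a`), and the range of `e·` is
  `A[a]`;
* §2 **`natCard_torsionBy_continuousCohomology_one` / `_two`**: `#H^q(G, M)[a] = #H^q(G, M[a])` for
  `q = 1, 2`, via `H^q` of the inclusion `ι : M[a] ⊆ M` and of the equivariant projection
  `π = e· : M → M[a]` (the tree's `ContinuousRep.torsionRep`, `torsionProj`,
  `cohomologyMap_one_eq_nsmul` of `LocalDualityTheorem.lean`, and the degree-`2` twin
  `cohomologyMap_two_eq_nsmul` proved here): `H^q(π) ∘ H^q(ι) = e = id` on `H^q(M[a])`,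
  `H^q(ι) ∘ H^q(π) = e` on `H^q(M)`;
* §3 **`natCard_torsionBy_invariants`**: `#M^G[a] = #M[a]^G`.

Consumers: `LocalEulerCharCoprime.lean` (Tate's local Euler–Poincaré characteristic and the
`(2,0)`-duality count at every level `n` prime to the residue characteristic), hence Milne I Thm. 2.6
at every `n` (route `SchneiderFreeAdditiveX3` of `Summits/BirchSwinnertonDyer`).

## References
* J.-P. Serre, *Galois Cohomology*, Springer (1997), I §2 (functoriality of cohomology). [SerreGaloisCohomology1997]
* J. S. Milne, *Arithmetic Duality Theorems*, 2nd ed. (2006), I §0, I §2. [MilneADT2006]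
-/

noncomputable section

open CategoryTheory Function

universe u

namespace Literature.NumberTheory.GaloisRepresentations

open _root_.TopRep _root_.ContRepresentation _root_.ContinuousCohomology DiscreteGaloisModule

/-! ### §1. Abelian groups killed by a product of two coprime integers -/

section Algebra

variable {A : Type*} [AddCommGroup A] {a b : ℕ}

/-- A CRT idempotent: `e ≡ 1 (mod a)`, `e ≡ 0 (mod b)` for coprime `a`, `b`.
[cite: Lang2002, Ch. II §2 Thm. 2.1 (Chinese Remainder Theorem)] -/
theorem exists_crt_one_zero (hab : a.Coprime b) : ∃ e : ℕ, e ≡ 1 [MOD a] ∧ e ≡ 0 [MOD b] := by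
  obtain ⟨e, he1, he0⟩ := Nat.chineseRemainder hab 1 0
  exact ⟨e, he1, he0⟩

/-- `e • y = y` when `a • y = 0` and `e ≡ 1 (mod a)`. [cite: Lang2002, Ch. II §2 Thm. 2.1 (consequence)] -/
theorem nsmul_eq_self_of_modEq_one {e : ℕ} (he : e ≡ 1 [MOD a]) {y : A} (hy : a • y = 0) :
    e • y = y := by
  rw [← ContinuousRep.mod_nsmul_eq hy e, show e % a = 1 % a from he, ContinuousRep.mod_nsmul_eq hy 1,
    one_nsmul]

/-- `e • y = 0` when `b • y = 0` and `e ≡ 0 (mod b)`. [folklore] -/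
private theorem nsmul_eq_zero_of_modEq_zero {e : ℕ} (he : e ≡ 0 [MOD b]) {y : A} (hy : b • y = 0) :
    e • y = 0 := by
  obtain ⟨t, rfl⟩ := (Nat.modEq_zero_iff_dvd.1 he)
  rw [mul_comm, mul_smul, hy, smul_zero]

/-- `a • (e • x) = 0` when `(a * b) • x = 0` and `e ≡ 0 (mod b)`.
[cite: Lang2002, Ch. II §2 Thm. 2.1 (consequence)] -/
theorem nsmul_nsmul_eq_zero_of_modEq_zero {e : ℕ} (he : e ≡ 0 [MOD b]) {x : A}
    (hx : (a * b) • x = 0) : a • e • x = 0 := by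
  obtain ⟨t, rfl⟩ := (Nat.modEq_zero_iff_dvd.1 he)
  rw [← mul_smul, show a * (b * t) = t * (a * b) by ring, mul_smul, hx, smul_zero]

/-- **`A ≃ A[a] × A[b]` for `a`, `b` coprime and `A` killed by `ab`**: with a CRT idempotent
`e ≡ 1 (a)`, `e ≡ 0 (b)`, `x ↦ (e x, x - e x)` with inverse `(y, z) ↦ y + z` (primary decomposition of a
torsion abelian group, two coprime factors). [cite: Lang2002, Ch. I §8 Thm. 8.1] -/
theorem exists_addEquiv_prod_torsionBy_of_coprime (hab : a.Coprime b) (hA : ∀ x : A, (a * b) • x = 0) :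
    Nonempty (A ≃+ AddSubgroup.torsionBy A a × AddSubgroup.torsionBy A b) := by
  obtain ⟨e, he1, he0⟩ := exists_crt_one_zero hab
  have hea : ∀ x : A, a • e • x = 0 := fun x => nsmul_nsmul_eq_zero_of_modEq_zero he0 (hA x)
  have heb : ∀ x : A, b • (x - e • x) = 0 := by
    intro x
    -- `b • (x - e x)`: `e ≡ 1 (a)` gives nothing here; use `e' = 1 + ab - e`? Simpler: `x - e•x` is
    -- killed by `b` since `(1 - e) ≡ 0 (mod b)` fails in ℕ; argue via `a`-torsion of `e x` instead:
    -- `b • x - b • e • x`, and `b • e • x = e • b • x`; we show `b • x = e • (b • x)`: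
    -- `a • (b • x) = 0`, so `e • (b • x) = b • x` by `e ≡ 1 (a)`.
    have h1 : a • (b • x) = 0 := by rw [← mul_nsmul', hA]
    rw [nsmul_sub, smul_comm, nsmul_eq_self_of_modEq_one he1 h1, sub_self]
  refine ⟨{ toFun := fun x => (⟨e • x, AddSubgroup.torsionBy.nsmul_iff.2 (hea x)⟩,
              ⟨x - e • x, AddSubgroup.torsionBy.nsmul_iff.2 (heb x)⟩)
            invFun := fun yz => (yz.1 : A) + (yz.2 : A)
            left_inv := fun x => by simp
            right_inv := fun yz => ?_
            map_add' := fun x x' => by ext <;> simp; abel }⟩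
  obtain ⟨⟨y, hy⟩, ⟨z, hz⟩⟩ := yz
  have hy' : a • y = 0 := AddSubgroup.torsionBy.nsmul_iff.1 hy
  have hz' : b • z = 0 := AddSubgroup.torsionBy.nsmul_iff.1 hz
  have hey : e • y = y := nsmul_eq_self_of_modEq_one he1 hy'
  have hez : e • z = 0 := nsmul_eq_zero_of_modEq_zero he0 hz'
  ext
  · change e • (y + z) = y
    rw [nsmul_add, hey, hez, add_zero]
  · change y + z - e • (y + z) = z
    rw [nsmul_add, hey, hez, add_zero, add_sub_cancel_left]

/-- **`#A = #A[a] · #A[b]`** for `a`, `b` coprime and `A` killed by `ab`. [cite: Lang2002, Ch. I §8 Thm. 8.1] -/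
theorem natCard_eq_mul_of_coprime (hab : a.Coprime b) (hA : ∀ x : A, (a * b) • x = 0) :
    Nat.card A = Nat.card (AddSubgroup.torsionBy A a) * Nat.card (AddSubgroup.torsionBy A b) := by
  obtain ⟨φ⟩ := exists_addEquiv_prod_torsionBy_of_coprime hab hA
  rw [Nat.card_congr φ.toEquiv, Nat.card_prod]

end Algebra

/-! ### §2. `H^q(G, M)[a] ≃ H^q(G, M[a])` for `q = 1, 2` (CRT idempotents on cohomology) -/

section Cohomology

variable {G : Type u} [Group G] [TopologicalSpace G] [IsTopologicalGroup G]
variable {M : Type u} [AddCommGroup M] [TopologicalSpace M] [DiscreteTopology M]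
variable (ρ : ContinuousRep G ℤ M)

/-- `H²(f) = e` on `H²(G, M)` for a morphism `f : M → M` with `f(m) = e m` (degree-`2` twin of the
tree's `cohomologyMap_one_eq_nsmul`). [cite: SerreGaloisCohomology1997, I §2.4] -/
theorem cohomologyMap_two_eq_nsmul [LocallyCompactSpace G] (f : ρ.toTopRep ⟶ ρ.toTopRep) (e : ℕ)
    (hf : ∀ m : M, f.hom m = e • m) (z : continuousCohomology 2 ρ.toTopRep) :
    cohomologyMap f 2 z = e • z := by
  obtain ⟨c, rfl⟩ := twoCocycleClass_surjective _ z
  rw [cohomologyMap_twoCocycleClass]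
  have hc : contTwoCocycles.pullback (ContinuousMonoidHom.id G) (resIdHom f) c = (e : ℤ) • c :=
    Subtype.ext (ContinuousMap.ext fun g => by
      obtain ⟨σ, τ⟩ := g
      rw [pullback₂_id_resIdHom_apply, hf]
      change e • c.1 (σ, τ) = ((e : ℤ) • c.1) (σ, τ)
      rw [ContinuousMap.smul_apply, natCast_zsmul])
  rw [hc, twoCocycleClass_smul, Nat.cast_smul_eq_nsmul]

variable {a b : ℕ}

omit [TopologicalSpace M] [DiscreteTopology M] in
/-- `(ab)/a ∣ e` for `e ≡ 0 (mod b)`, `a ≠ 0` (the divisibility fed to `torsionProj`).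
[cite: Lang2002, Ch. II §2 Thm. 2.1 (consequence)] -/
theorem div_dvd_of_modEq_zero (ha : a ≠ 0) {e : ℕ} (he0 : e ≡ 0 [MOD b]) : a * b / a ∣ e := by
  rw [Nat.mul_div_cancel_left b (Nat.pos_of_ne_zero ha)]
  exact Nat.modEq_zero_iff_dvd.1 he0

omit [TopologicalSpace M] [DiscreteTopology M] in
/-- Elements of `M[a]` are killed by `a` (in the subtype). [cite: Lang2002, Ch. I §8 (torsion subgroups)] -/
theorem nsmul_torsionRep_eq_zero (a : ℕ) (m : Submodule.torsionBy ℤ M (a : ℤ)) : a • m = 0 :=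
  Subtype.ext ((ContinuousRep.mem_torsionBy_nsmul_iff a).1 m.2)

/-- **`H¹(G, M[a]) → H¹(G, M)` is injective with image `H¹(G, M)[a]`** for `a`, `b` coprime, `a ≠ 0`,
`M` killed by `ab`: `H¹(π) ∘ H¹(ι) = e = id` on `H¹(M[a])` and `H¹(ι) ∘ H¹(π) = e` on `H¹(M)` for the
inclusion `ι` and the projection `π = e·` (`torsionProj`), `e` a CRT idempotent; hence
**`#H¹(G, M)[a] = #H¹(G, M[a])`** (cohomology commutes with the primary decomposition).
[cite: SerreGaloisCohomology1997, I §2.2 and §2.4] -/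
theorem natCard_torsionBy_continuousCohomology_one (hab : a.Coprime b) (ha : a ≠ 0)
    (hM : ∀ m : M, (a * b) • m = 0) :
    Nat.card (AddSubgroup.torsionBy (continuousCohomology 1 ρ.toTopRep) a) =
      Nat.card (continuousCohomology 1 (ρ.torsionRep a).toTopRep) := by
  obtain ⟨e, he1, he0⟩ := exists_crt_one_zero hab
  let π := torsionProj ρ hM a e (dvd_mul_right a b) (div_dvd_of_modEq_zero ha he0)
  let ι := ρ.torsionIncl a
  -- `H¹(ι ≫ π) = e = id` on `H¹(M[a])`
  have h1 : ∀ x : continuousCohomology 1 (ρ.torsionRep a).toTopRep,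
      cohomologyMap π 1 (cohomologyMap ι 1 x) = x := by
    intro x
    have hcomp : cohomologyMap π 1 (cohomologyMap ι 1 x) = cohomologyMap (ι ≫ π) 1 x :=
      (map_comp_apply_of (ContinuousMonoidHom.id _) (ContinuousMonoidHom.id _) (ContinuousMonoidHom.id _)
        (fun _ => rfl) (resIdHom ι) (resIdHom π) (resIdHom (ι ≫ π)) (fun _ => rfl) 1 x).symm
    have he : cohomologyMap (ι ≫ π) 1 x = e • x :=
      cohomologyMap_one_eq_nsmul (ρ.torsionRep a) _ e (fun m => Subtype.ext rfl) x
    rw [hcomp, he]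
    exact nsmul_eq_self_of_modEq_one he1
      (nsmul_continuousCohomology_one_eq_zero _ a (nsmul_torsionRep_eq_zero a) x)
  -- `H¹(π ≫ ι) = e` on `H¹(M)`
  have h2 : ∀ y : continuousCohomology 1 ρ.toTopRep,
      cohomologyMap ι 1 (cohomologyMap π 1 y) = e • y := by
    intro y
    have hcomp : cohomologyMap ι 1 (cohomologyMap π 1 y) = cohomologyMap (π ≫ ι) 1 y :=
      (map_comp_apply_of (ContinuousMonoidHom.id _) (ContinuousMonoidHom.id _) (ContinuousMonoidHom.id _)
        (fun _ => rfl) (resIdHom π) (resIdHom ι) (resIdHom (π ≫ ι)) (fun _ => rfl) 1 y).symm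
    rw [hcomp]
    exact cohomologyMap_one_eq_nsmul ρ _ e (fun _ => rfl) y
  -- the bijection `H¹(M[a]) → H¹(M)[a]`
  have hmem : ∀ x : continuousCohomology 1 (ρ.torsionRep a).toTopRep,
      cohomologyMap ι 1 x ∈ AddSubgroup.torsionBy (continuousCohomology 1 ρ.toTopRep) a := by
    intro x
    rw [AddSubgroup.torsionBy.nsmul_iff, ← map_nsmul,
      nsmul_continuousCohomology_one_eq_zero _ a (nsmul_torsionRep_eq_zero a) x, map_zero]
  refine (Nat.card_congr (Equiv.ofBijective (fun x => (⟨cohomologyMap ι 1 x, hmem x⟩ :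
    AddSubgroup.torsionBy (continuousCohomology 1 ρ.toTopRep) a)) ⟨fun x x' hxx' => ?_, fun y => ?_⟩)).symm
  · have h := congrArg (fun z : AddSubgroup.torsionBy (continuousCohomology 1 ρ.toTopRep) a =>
      cohomologyMap π 1 (z : continuousCohomology 1 ρ.toTopRep)) hxx'
    simpa only [h1] using h
  · refine ⟨cohomologyMap π 1 (y : continuousCohomology 1 ρ.toTopRep), Subtype.ext ?_⟩
    change cohomologyMap ι 1 (cohomologyMap π 1 (y : continuousCohomology 1 ρ.toTopRep)) = y
    rw [h2]
    exact nsmul_eq_self_of_modEq_one he1 (AddSubgroup.torsionBy.nsmul_iff.1 y.2)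

/-- **`#H²(G, M)[a] = #H²(G, M[a])`** for `a`, `b` coprime, `a ≠ 0`, `M` killed by `ab` (as in degree
`1`, with `cohomologyMap_two_eq_nsmul`). [cite: SerreGaloisCohomology1997, I §2.2 and §2.4] -/
theorem natCard_torsionBy_continuousCohomology_two [LocallyCompactSpace G] (hab : a.Coprime b)
    (ha : a ≠ 0) (hM : ∀ m : M, (a * b) • m = 0) :
    Nat.card (AddSubgroup.torsionBy (continuousCohomology 2 ρ.toTopRep) a) =
      Nat.card (continuousCohomology 2 (ρ.torsionRep a).toTopRep) := by
  obtain ⟨e, he1, he0⟩ := exists_crt_one_zero hab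
  let π := torsionProj ρ hM a e (dvd_mul_right a b) (div_dvd_of_modEq_zero ha he0)
  let ι := ρ.torsionIncl a
  have h1 : ∀ x : continuousCohomology 2 (ρ.torsionRep a).toTopRep,
      cohomologyMap π 2 (cohomologyMap ι 2 x) = x := by
    intro x
    have hcomp : cohomologyMap π 2 (cohomologyMap ι 2 x) = cohomologyMap (ι ≫ π) 2 x :=
      (map_comp_apply_of (ContinuousMonoidHom.id _) (ContinuousMonoidHom.id _) (ContinuousMonoidHom.id _)
        (fun _ => rfl) (resIdHom ι) (resIdHom π) (resIdHom (ι ≫ π)) (fun _ => rfl) 2 x).symm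
    have he : cohomologyMap (ι ≫ π) 2 x = e • x :=
      cohomologyMap_two_eq_nsmul (ρ.torsionRep a) _ e (fun m => Subtype.ext rfl) x
    rw [hcomp, he]
    exact nsmul_eq_self_of_modEq_one he1
      (nsmul_continuousCohomology_two_eq_zero _ a (nsmul_torsionRep_eq_zero a) x)
  have h2 : ∀ y : continuousCohomology 2 ρ.toTopRep,
      cohomologyMap ι 2 (cohomologyMap π 2 y) = e • y := by
    intro y
    have hcomp : cohomologyMap ι 2 (cohomologyMap π 2 y) = cohomologyMap (π ≫ ι) 2 y :=
      (map_comp_apply_of (ContinuousMonoidHom.id _) (ContinuousMonoidHom.id _) (ContinuousMonoidHom.id _)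
        (fun _ => rfl) (resIdHom π) (resIdHom ι) (resIdHom (π ≫ ι)) (fun _ => rfl) 2 y).symm
    rw [hcomp]
    exact cohomologyMap_two_eq_nsmul ρ _ e (fun _ => rfl) y
  have hmem : ∀ x : continuousCohomology 2 (ρ.torsionRep a).toTopRep,
      cohomologyMap ι 2 x ∈ AddSubgroup.torsionBy (continuousCohomology 2 ρ.toTopRep) a := by
    intro x
    rw [AddSubgroup.torsionBy.nsmul_iff, ← map_nsmul,
      nsmul_continuousCohomology_two_eq_zero _ a (nsmul_torsionRep_eq_zero a) x, map_zero]
  refine (Nat.card_congr (Equiv.ofBijective (fun x => (⟨cohomologyMap ι 2 x, hmem x⟩ :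
    AddSubgroup.torsionBy (continuousCohomology 2 ρ.toTopRep) a)) ⟨fun x x' hxx' => ?_, fun y => ?_⟩)).symm
  · have h := congrArg (fun z : AddSubgroup.torsionBy (continuousCohomology 2 ρ.toTopRep) a =>
      cohomologyMap π 2 (z : continuousCohomology 2 ρ.toTopRep)) hxx'
    simpa only [h1] using h
  · refine ⟨cohomologyMap π 2 (y : continuousCohomology 2 ρ.toTopRep), Subtype.ext ?_⟩
    change cohomologyMap ι 2 (cohomologyMap π 2 (y : continuousCohomology 2 ρ.toTopRep)) = y
    rw [h2]
    exact nsmul_eq_self_of_modEq_one he1 (AddSubgroup.torsionBy.nsmul_iff.1 y.2)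

end Cohomology

/-! ### §3. `M^G[a] ≃ M[a]^G` -/

section Invariants

variable {G : Type u} [Group G] [TopologicalSpace G] [IsTopologicalGroup G]
variable {M : Type u} [AddCommGroup M] [TopologicalSpace M] [DiscreteTopology M]
variable (ρ : ContinuousRep G ℤ M)

omit [IsTopologicalGroup G] in
/-- **`#M^G[a] = #M[a]^G`**: an `a`-torsion invariant is an invariant of the `a`-torsion
sub-representation (both are `{m ∈ M | a m = 0, σ m = m}`). [cite: SerreGaloisCohomology1997, I §2.2] -/
theorem natCard_torsionBy_invariants (a : ℕ) :
    Nat.card (AddSubgroup.torsionBy ρ.toTopRep.ρ.invariants a) =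
      Nat.card (ρ.torsionRep a).toTopRep.ρ.invariants := by
  refine Nat.card_congr
    { toFun := fun y => ⟨⟨(y.1 : M), (ContinuousRep.mem_torsionBy_nsmul_iff a).2 ?_⟩, fun g =>
        Subtype.ext ?_⟩
      invFun := fun w => ⟨⟨(w.1 : M), fun g => ?_⟩, ?_⟩
      left_inv := fun y => rfl
      right_inv := fun w => rfl }
  · have h := congrArg Subtype.val (AddSubgroup.torsionBy.nsmul_iff.1 y.2)
    simpa using h
  · change ρ g (y.1 : M) = y.1
    exact y.1.2 g
  · change ρ g (w.1 : M) = w.1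
    exact congrArg Subtype.val (w.2 g)
  · rw [AddSubgroup.torsionBy.nsmul_iff]
    apply Subtype.ext
    have h : a • (w.1 : M) = 0 := (ContinuousRep.mem_torsionBy_nsmul_iff a).1 w.1.2
    simpa using h

end Invariants

end Literature.NumberTheory.GaloisRepresentations

end
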